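import Mathlib
import Summits.Ventures.PercRepro2.ThreeTermPartKernel

/-!
# The per-copy pinned count under a change of the part configurations, with three bases
(blind cell PercRepro2, night-3 g31, 2026-08-30; `proofs/NIGHT3-CERT.md` §40.11)

`ThreeTermPartKernel.typedCount3_setOn_eq` / `typedCount3_part` (night-3 g29) pin the three copies on
`setOn S a z`, `setOn S b z`, `setOn S c z` with ONE base `z`.  Here the same statements with THREE
bases `z₁ z₂ z₃` (the fibres are matched copy by copy, exactly as in g29's proof):

* **`typedCount3_setOn_eq3`**: if the kernel at the fibre configurations equals a kernel `K'` at their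
  overwrites by `a', b', c'`, the pinned count at `(a, b, c)` over `(z₁, z₂, z₃)` is the pinned count of
  `K'` at `(a', b', c')` over `(z₁, z₂, z₃)`;
* **`typedCount3_part3`**: the gadget law termwise with three bases — the per-copy pinned count of
  core + part at part configurations `a, b, c` is the pinned count of the part graph at the pattern
  configurations `pm a, pm b, pm c`, whatever the three bases.

The tool for a part INSIDE a core whose three copies are pinned differently (the nested-part table of
§40.3, NOT DONE (v)).  Own work; standard axioms.
-/

namespace Summit.Ventures.PercRepro2

open Block

namespace Part

section Reindex3

variable {E : Type*} [Fintype E] [DecidableEq E] {R : Type*} [CommRing R]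

/-- **The per-copy pinned count under a change of the part configurations, three bases.** -/
theorem typedCount3_setOn_eq3 {F S : Finset E} (hd : Disjoint F S) (z₁ z₂ z₃ : Config E) (τ : E → ℕ)
    (a b c a' b' c' : Config E) (K K' : Config E → Config E → Config E → R)
    (hK : ∀ x y w, (∀ e, e ∉ F → x e = TypedStar.setOn S a z₁ e) →
      (∀ e, e ∉ F → y e = TypedStar.setOn S b z₂ e) → (∀ e, e ∉ F → w e = TypedStar.setOn S c z₃ e) →
      K x y w = K' (TypedStar.setOn S a' x) (TypedStar.setOn S b' y) (TypedStar.setOn S c' w)) :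
    TypedStar.typedCount3 F (TypedStar.setOn S a z₁) (TypedStar.setOn S b z₂) (TypedStar.setOn S c z₃) τ K =
      TypedStar.typedCount3 F (TypedStar.setOn S a' z₁) (TypedStar.setOn S b' z₂)
        (TypedStar.setOn S c' z₃) τ K' := by
  unfold TypedStar.typedCount3
  have hτ : ∀ x y w : Config E, (∀ e ∈ F, openCount (TypedStar.setOn S a' x) (TypedStar.setOn S b' y)
      (TypedStar.setOn S c' w) e = τ e) ↔ (∀ e ∈ F, openCount x y w e = τ e) := by
    intro x y w
    refine forall₂_congr fun e he => ?_
    rw [openCount_setOn_of_notMem (fun hS => Finset.disjoint_left.mp hd he hS)]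
  have hL : ∀ x y w : Config E,
      (if (∀ e, e ∉ F → x e = TypedStar.setOn S a z₁ e ∧ y e = TypedStar.setOn S b z₂ e ∧
            w e = TypedStar.setOn S c z₃ e) ∧ (∀ e ∈ F, openCount x y w e = τ e) then K x y w else 0) =
      (if (∀ e, e ∉ F → x e = TypedStar.setOn S a z₁ e) then
        (if (∀ e, e ∉ F → y e = TypedStar.setOn S b z₂ e) then
          (if (∀ e, e ∉ F → w e = TypedStar.setOn S c z₃ e) then
            (if (∀ e ∈ F, openCount (TypedStar.setOn S a' x) (TypedStar.setOn S b' y)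
                (TypedStar.setOn S c' w) e = τ e) then
              K' (TypedStar.setOn S a' x) (TypedStar.setOn S b' y) (TypedStar.setOn S c' w) else 0)
          else 0) else 0) else 0) := by
    intro x y w
    by_cases hx : ∀ e, e ∉ F → x e = TypedStar.setOn S a z₁ e
    · by_cases hy : ∀ e, e ∉ F → y e = TypedStar.setOn S b z₂ e
      · by_cases hw : ∀ e, e ∉ F → w e = TypedStar.setOn S c z₃ e
        · have hc : ∀ e, e ∉ F → x e = TypedStar.setOn S a z₁ e ∧ y e = TypedStar.setOn S b z₂ e ∧
              w e = TypedStar.setOn S c z₃ e := (cond3_iff _ _ _ x y w).2 ⟨hx, hy, hw⟩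
          rw [if_pos hx, if_pos hy, if_pos hw]
          by_cases ht : ∀ e ∈ F, openCount x y w e = τ e
          · rw [if_pos ⟨hc, ht⟩, if_pos ((hτ x y w).2 ht), hK x y w hx hy hw]
          · rw [if_neg (fun h => ht h.2), if_neg (fun h => ht ((hτ x y w).1 h))]
        · rw [if_neg (fun h => hw ((cond3_iff _ _ _ x y w).1 h.1).2.2), if_pos hx, if_pos hy, if_neg hw]
      · rw [if_neg (fun h => hy ((cond3_iff _ _ _ x y w).1 h.1).2.1), if_pos hx, if_neg hy]
    · rw [if_neg (fun h => hx ((cond3_iff _ _ _ x y w).1 h.1).1), if_neg hx]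
  have hR : ∀ x y w : Config E,
      (if (∀ e, e ∉ F → x e = TypedStar.setOn S a' z₁ e ∧ y e = TypedStar.setOn S b' z₂ e ∧
            w e = TypedStar.setOn S c' z₃ e) ∧ (∀ e ∈ F, openCount x y w e = τ e) then K' x y w else 0) =
      (if (∀ e, e ∉ F → x e = TypedStar.setOn S a' z₁ e) then
        (if (∀ e, e ∉ F → y e = TypedStar.setOn S b' z₂ e) then
          (if (∀ e, e ∉ F → w e = TypedStar.setOn S c' z₃ e) then
            (if (∀ e ∈ F, openCount x y w e = τ e) then K' x y w else 0)
          else 0) else 0) else 0) := by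
    intro x y w
    by_cases hx : ∀ e, e ∉ F → x e = TypedStar.setOn S a' z₁ e
    · by_cases hy : ∀ e, e ∉ F → y e = TypedStar.setOn S b' z₂ e
      · by_cases hw : ∀ e, e ∉ F → w e = TypedStar.setOn S c' z₃ e
        · have hc : ∀ e, e ∉ F → x e = TypedStar.setOn S a' z₁ e ∧ y e = TypedStar.setOn S b' z₂ e ∧
              w e = TypedStar.setOn S c' z₃ e := (cond3_iff _ _ _ x y w).2 ⟨hx, hy, hw⟩
          rw [if_pos hx, if_pos hy, if_pos hw]
          by_cases ht : ∀ e ∈ F, openCount x y w e = τ e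
          · rw [if_pos ⟨hc, ht⟩, if_pos ht]
          · rw [if_neg (fun h => ht h.2), if_neg ht]
        · rw [if_neg (fun h => hw ((cond3_iff _ _ _ x y w).1 h.1).2.2), if_pos hx, if_pos hy, if_neg hw]
      · rw [if_neg (fun h => hy ((cond3_iff _ _ _ x y w).1 h.1).2.1), if_pos hx, if_neg hy]
    · rw [if_neg (fun h => hx ((cond3_iff _ _ _ x y w).1 h.1).1), if_neg hx]
  simp only [hL, hR, sum_ite_const']
  rw [sum_fibre_setOn hd z₁ a a' (fun x => ∑ y : Config E,
    if (∀ e, e ∉ F → y e = TypedStar.setOn S b z₂ e) then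
      (∑ w : Config E, if (∀ e, e ∉ F → w e = TypedStar.setOn S c z₃ e) then
        (if (∀ e ∈ F, openCount x (TypedStar.setOn S b' y) (TypedStar.setOn S c' w) e = τ e) then
          K' x (TypedStar.setOn S b' y) (TypedStar.setOn S c' w) else 0) else 0) else 0)]
  refine Finset.sum_congr rfl fun x _ => ?_
  split_ifs with hx
  · rw [sum_fibre_setOn hd z₂ b b' (fun y => ∑ w : Config E,
      if (∀ e, e ∉ F → w e = TypedStar.setOn S c z₃ e) then
        (if (∀ e ∈ F, openCount x y (TypedStar.setOn S c' w) e = τ e) then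
          K' x y (TypedStar.setOn S c' w) else 0) else 0)]
    refine Finset.sum_congr rfl fun y _ => ?_
    split_ifs with hy
    · rw [sum_fibre_setOn hd z₃ c c' (fun w =>
        if (∀ e ∈ F, openCount x y w e = τ e) then K' x y w else 0)]
    · rfl
  · rfl

end Reindex3

section Typed3

variable {V : Type*} {E : Type*} [Fintype E] [DecidableEq E] {R : Type*} [Field R]

/-- **The gadget law termwise, three bases.** -/
theorem typedCount3_part3 {ends : E → Sym2 V} {W : Set V} {t₁ t₂ t₃ : V}
    (hW : IsPart ends W t₁ t₂ t₃) {S : Finset E} (hS : ∀ e, e ∈ S ↔ e ∈ touches ends W)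
    {e₁ e₂ e₃ : E} (h1 : e₁ ∈ S) (h2 : e₂ ∈ S) (h3 : e₃ ∈ S) (h12 : e₁ ≠ e₂) (h13 : e₁ ≠ e₃)
    (h23 : e₂ ≠ e₃) {o a₁ a₂ a₃ b : V} (ho : o ∉ W) (ha₁ : a₁ ∉ W) (ha₂ : a₂ ∉ W) (ha₃ : a₃ ∉ W)
    (hb : b ∉ W) {F : Finset E} (hd : Disjoint F S) (z₁ z₂ z₃ : Config E) (τ : E → ℕ)
    (a b' c : Config E) :
    TypedStar.typedCount3 F (TypedStar.setOn S a z₁) (TypedStar.setOn S b' z₂) (TypedStar.setOn S c z₃) τ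
        (CovForm.K3 (R := R) ends o a₁ a₂ a₃ b) =
      TypedStar.typedCount3 F (TypedStar.setOn S (pm ends (↑S) e₁ e₂ e₃ t₁ t₂ t₃ a) z₁)
        (TypedStar.setOn S (pm ends (↑S) e₁ e₂ e₃ t₁ t₂ t₃ b') z₂)
        (TypedStar.setOn S (pm ends (↑S) e₁ e₂ e₃ t₁ t₂ t₃ c) z₃) τ
        (CovForm.K3 (R := R) (partEnds ends (↑S) e₁ e₂ e₃ t₁ t₂ t₃) o a₁ a₂ a₃ b) := by
  have hS' : ∀ e, e ∈ (↑S : Set E) ↔ e ∈ touches ends W := fun e => by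
    rw [Finset.mem_coe]; exact hS e
  have h1' : e₁ ∈ (↑S : Set E) := Finset.mem_coe.2 h1
  have h2' : e₂ ∈ (↑S : Set E) := Finset.mem_coe.2 h2
  have h3' : e₃ ∈ (↑S : Set E) := Finset.mem_coe.2 h3
  refine typedCount3_setOn_eq3 hd z₁ z₂ z₃ τ a b' c _ _ _ _ _ fun x y w hx hy hw => ?_
  rw [K3_part hW hS' h1' h2' h3' h12 h13 h23 ho ha₁ ha₂ ha₃ hb x y w]
  have hxa : ∀ e ∈ S, x e = a e := fun e he => by
    have heF : e ∉ F := fun hF => Finset.disjoint_left.mp hd hF he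
    rw [hx e heF, TypedStar.setOn_of_mem he]
  have hyb : ∀ e ∈ S, y e = b' e := fun e he => by
    have heF : e ∉ F := fun hF => Finset.disjoint_left.mp hd hF he
    rw [hy e heF, TypedStar.setOn_of_mem he]
  have hwc : ∀ e ∈ S, w e = c e := fun e he => by
    have heF : e ∉ F := fun hF => Finset.disjoint_left.mp hd hF he
    rw [hw e heF, TypedStar.setOn_of_mem he]
  rw [pm_eq_setOn ends S h1 h2 h3 t₁ t₂ t₃ hxa, pm_eq_setOn ends S h1 h2 h3 t₁ t₂ t₃ hyb,
    pm_eq_setOn ends S h1 h2 h3 t₁ t₂ t₃ hwc]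

end Typed3

end Part

end Summit.Ventures.PercRepro2
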